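import Summits.AnomalousDissipation.AnomalousDissipation.Theorems.MarginalStabilityChainStrainedLayerLawSumRuleLine
import Summits.AnomalousDissipation.AnomalousDissipation.Theorems.MarginalStabilityChainStrainedLayerLawStubCoreFloor
import Summits.AnomalousDissipation.AnomalousDissipation.Theorems.MarginalStabilityChainStrainedLayerLawSumRuleShearTails
import HarnessLib.Audit

/-!
# Line `ordered-ribbon-forged-core` — checked skeleton for crux `MarginalStabilityChain.StrainedLayerLaw`
(item stmt-AnomalousDissipation-3007, route route-AnomalousDissipation-MarginalStabilityChain; planner crux-plan,
idea card `Cruxes/StrainedLayerLaw/Ideas/ordered-ribbon-forged-core.md`, triage r2-1/r2-2/r2-3 PASS)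

Crux (FIXED; `Theses/MarginalStabilityChain.lean`): `∃ c > 0 ∀ L > 0 ∃ ν₀ > 0 ∃ θ` admissible `∀ ν ∈ (0,ν₀] ∀ (u,v,p)`
global classical solutions of the stretched 2-D Navier–Stokes class (γ = ΔU = 1, period `L`) from `U_B^ν + θ`:
`ofReal (c·min L 1) ≤ liminf_T ofReal T⁻¹ ∫⁻_{(0,T]} D`.

## The line (one paragraph) — DESIGN the datum, FORGE the core, read a LOCATED core out by Cauchy–Schwarz
`θ` is the ORDERED RIBBON (top to bottom: a row of fat Gaussian blobs `−L` per period at height `h` | a vorticity-free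
moat | the Burgers sheet `−U_B′` (the datum, not part of `θ`) | a parallel antilayer `+L` centred at `−y_a`; zero net
circulation as admissibility forces). (S1 `stub_kidaNeuForge`, ODE) the carrier `(0, −y)` = isotropic compression + pure
strain forges a fast-rotating blob into a ROUND core whose area shrinks like `e^{−t}` — the Kida–Neu ellipse never takes the
layer branch above a rotation threshold `|ω₀| ≥ K`; (S2 `stub_ribbonDatum`) the ribbon is realised by an admissible `θ`;
(S3 `stub_ribbonForgePurge`, given S1) for ONE ribbon geometry per `L` and ν-FREE ledger constants `κ > μ ≥ 0`, `C > 0`, every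
tailed member from `U_B^ν + θ`, `ν ≤ ν₀(L)`, reaches at SOME time `t₀` (fixed-ν, per member — no rate, no ordering of
arrival vs annihilation assumed) a PURGED LOCATED CORE: a box of half-side `C√ν` with signed circulation `≤ −κL` while the
cell's positive vorticity is `≤ μL` (`IsPurgedCore`; forge + shielded melee: `+` reaches the blob only through the `−` sheet);
(S4 `stub_corePersistence`, θ-FREE, HARDEST) a purged located core with ledger margin `κ − μ > 0` PERSISTS: from some `T₁` on
every slice has a box of half-side `C′√ν` with `|Γ_box| ≥ κ′L`, `κ′, C′` depending on `κ, μ, C` only (ν-uniform robustness of the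
plane-strain Burgers vortex row at `Re_Γ = κL/ν → ∞`; `M₊` is non-increasing, so at most `μL` of the core can ever be
annihilated). READ-OUT = the LANDED `stub_coreFloor` (p86383, Cauchy–Schwarz on the box + Cesàro, entirely in `ℝ≥0∞`): `D ≥
ν(κ′L)²/(8(C′√ν)²L) = κ′²L/(8C′²)` eventually, ν cancels, `c := κ′²/(8C′²)`. No clock, no roundness/palinstrophy, no capture,
no time-mean floor for an unspecified θ: the two dynamical stubs are fixed-ν EVENTUAL statements whose only ν-uniform content
is three ledger constants, and S4 quantifies over a θ-free hypothesis class (purged-core members of the bare Literature class)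
on which the Disproof's parallel witnesses (§2, §4, §4b) are vacuous (an `x`-independent slice has `|Γ_box| ≤ 2C√ν·(1 + μ)`,
`< κL` once `ν` is small). Hygiene (S5 `stub_bareClassTails`) is the sum-rule line's registered signature VERBATIM (repair-only in the bare class;
conditional closure `bareClassTails_of_hasShearLayerTails`, p120875, imported for the record); the `⊤`-dichotomy on local
finiteness of `∫⁻ D` is proved inside the composition.

Composition (sorry-free, kernel-checked): `StrainedLayerLaw_of_ribbonStubs h1 h2 h3 h4 h5 : StrainedLayerLaw`;
`StrainedLayerLaw_of : StrainedLayerLaw` applies it to the five `stub_*` (sorries ONLY there).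
-/

set_option linter.dupNamespace false

noncomputable section

open scoped BigOperators Topology ENNReal
open Filter Set Function MeasureTheory

namespace Summit.AnomalousDissipation.AnomalousDissipation.Cruxes.StrainedLayerLaw.OrderedRibbonForgedCore

open Literature.Analysis.FluidPDE Literature.Analysis.FluidPDE.StretchedLayer
open Summit.AnomalousDissipation.AnomalousDissipation.Theses.MarginalStabilityChain
open Summit.AnomalousDissipation.AnomalousDissipation.Theorems.StrainedLayerLaw.StrainWorkSumRule
open Summit.AnomalousDissipation.AnomalousDissipation.Theorems.StrainedLayerLaw.ContractionCapture
  (vort boxCirc cellPosVort stub_coreFloor)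

/-! ## §0 Vocabulary of the line (definitions only; S1/S2 objects verbatim from `Cruxes/StrainedLayerLaw/FirstLemmasR2K4.lean` §A) -/

/-- **Kida–Neu forge trajectory** (regular shape coordinates). A uniform-vorticity ellipse in the crux's carrier field
`(0, −y)` = isotropic compression `−½(x, y)` + pure strain `(½x, −½y)`, plus its own Kirchhoff self-induction, stays an exact
ellipse; its vorticity is `ω(t) = ω₀eᵗ` (axial stretching), its area `A₀e^{−t}`, and its SHAPE `(p, q) = m·(cos 2θ, sin 2θ)`,
`m = (λ − 1)/(λ + 1)` (`λ = a/b` the aspect ratio, `θ` the angle of the major axis to the `x`-axis), obeys the planar system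
below (Kida 1981; Neu 1984 / Majda–Bertozzi Example 8.2 with the time-dependent vorticity `ω₀eᵗ` and strain `½`, rewritten on
the unit disc so that the circle `m = 0` is a regular point). Verbatim `SketchR2K4.IsForgeTrajectory`. -/
def IsForgeTrajectory (ω₀ : ℝ) (p q : ℝ → ℝ) : Prop :=
  ∀ t : ℝ, 0 ≤ t →
    HasDerivAt p ((1 - p t ^ 2 + q t ^ 2) / 2 - ω₀ * Real.exp t / 2 * (1 - p t ^ 2 - q t ^ 2) * q t) t ∧
    HasDerivAt q (-(p t * q t) + ω₀ * Real.exp t / 2 * (1 - p t ^ 2 - q t ^ 2) * p t) t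

/-- **S1 · the compression forges a round core** (fast-rotation boundedness of the Kida–Neu system). There are `K > 0` and
`m⋆ < 1` such that every forge trajectory with `|ω₀| ≥ K` started at aspect ratio `λ₀ ≤ 2` (`m₀² ≤ 1/9`) keeps `m(t)² ≤ m⋆²`
for all `t ≥ 0`: the fat blob never flattens into a layer while the compression thins it to the Burgers scale. (ODE scans on
the item: `K = 2 ⇒ sup λ ≤ 8.33`, `K = 20 ⇒ ≤ 2.44`, `K = 44 ⇒ ≤ 2.20`; the layer branch is real only for `|ω₀| ≲ 0.75`.)
Verbatim `SketchR2K4.KidaNeuForge`. -/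
def KidaNeuForge : Prop :=
  ∃ K m : ℝ, 0 < K ∧ m < 1 ∧ ∀ (ω₀ : ℝ) (p q : ℝ → ℝ), K ≤ |ω₀| → IsForgeTrajectory ω₀ p q →
    p 0 ^ 2 + q 0 ^ 2 ≤ 1 / 9 → ∀ t : ℝ, 0 ≤ t → p t ^ 2 + q t ^ 2 ≤ m ^ 2

/-- The ORDERED-RIBBON vorticity design (top to bottom: blob row `−L` per period at height `h`, width `s_b` | vorticity-free
moat | the Burgers sheet `−U_B′` (datum, not part of `θ`) | antilayer `+L` per period, parallel, centred at `−y_a`, width `s_a`):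
`ω_d(x, y) = −(L/2πs_b²) Σ_{j∈ℤ} e^{−((x − jL)² + (y − h)²)/2s_b²} + (1/(s_a√(2π))) e^{−(y + y_a)²/2s_a²}`.
Verbatim `SketchR2K4.ribbonVorticity`. -/
def ribbonVorticity (L h s_b y_a s_a : ℝ) (x y : ℝ) : ℝ :=
  -(L / (2 * Real.pi * s_b ^ 2)) * (∑' j : ℤ, Real.exp (-((x - j * L) ^ 2 + (y - h) ^ 2) / (2 * s_b ^ 2))) +
    (1 / (s_a * Real.sqrt (2 * Real.pi))) * Real.exp (-(y + y_a) ^ 2 / (2 * s_a ^ 2))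

/-- **S2 · the ribbon datum is admissible up to an arbitrarily small far correction.** For every geometry and every
`η, R₀ > 0` there is an admissible `θ` (C², `L`-periodic, compactly supported in `y`, divergence-free — zero net circulation is
automatic) whose vorticity EQUALS `ribbonVorticity` on `|y| ≤ R₀` and differs from it by at most `η` in `L¹` of the period
strip (construction: `θ = ∇⊥(χ_R ψ_d)`, `Δψ_d = ω_d`, cut-off radius `R ≫ R₀`; the `k ≠ 0` modes of `ψ_d` decay like
`e^{−2π|k||y|/L}`, the `k = 0` mode tends to constants with Gaussian speed). Verbatim `SketchR2K4.RibbonDatum`. -/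
def RibbonDatum : Prop :=
  ∀ L h s_b y_a s_a η R₀ : ℝ, 0 < L → 0 < s_b → 0 < s_a → 0 < y_a → 0 < h → 0 < η → 0 < R₀ →
    ∃ θ₁ θ₂ : ℝ → ℝ → ℝ, IsAdmissible L θ₁ θ₂ ∧
      (∀ x y, |y| ≤ R₀ → vorticity θ₁ θ₂ x y = ribbonVorticity L h s_b y_a s_a x y) ∧
      ∫ x in Ioc 0 L, ∫ y, |vorticity θ₁ θ₂ x y - ribbonVorticity L h s_b y_a s_a x y| ≤ η

/-- **Purged located core** of a slice `(f, g)` of period `L` with ledger constants `κ, μ` at radius `ρ`: SOME box of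
half-side `ρ` carries SIGNED circulation `≤ −κL` (`boxCirc`, iterated Bochner integral of `ω = ∂ₓg − ∂_yf`; a non-integrable
box gives the junk value `0`, which FAILS the clause), and the positive-vorticity mass of the period cell centred at the same
`a` is `≤ μL` (`cellPosVort`, a lower Lebesgue integral: a non-integrable `ω₊` gives `⊤`, which FAILS the clause). With
`μ < κ` at most `μL` of the core's `−κL` can ever be annihilated (`M₊` is non-increasing along tailed solutions). -/
def IsPurgedCore (L κ μ ρ : ℝ) (f g : ℝ → ℝ → ℝ) : Prop :=
  ∃ a b : ℝ, boxCirc f g a b ρ ≤ -(κ * L) ∧ cellPosVort L f g a ≤ ENNReal.ofReal (μ * L)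

/-- **S3's statement · forge-and-purge on the ribbon datum.** There are ν-FREE, `L`-FREE ledger constants `0 ≤ μ < κ`, `C > 0`
such that for every period `L` ONE ribbon geometry `(h, s_b, y_a, s_a)` and tolerances `(η, R₀)` work: for every admissible `θ`
realising that ribbon (vorticity `= ω_d` on `|y| ≤ R₀`, `L¹`-error `≤ η`) there is `ν₀ > 0` such that for all `ν ∈ (0, ν₀]`
every member of the crux's class from `U_B^ν + θ` with shear tails on compact time windows has, at SOME time `t₀ > 0`, a purged
located core `IsPurgedCore L κ μ (C√ν)`. Fixed-ν, per-member, existential in `t₀`: the forge (S1, log-window `t ≲ ln(s_b²/ν)`,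
finite-time ν-uniform tracking before the blob meets the band at `t ≈ 2 ln(h/3s_b)`), the shielded melee (all `+` starts below
the non-contractible `−` sheet; a `±` debris pair reaching the blob changes its circulation by zero net) and enough annihilation
of `+` against `−` (`> (1 − κ + μ)`-bookkeeping) are its content; NO claim that the band annihilates before the blob arrives. -/
def RibbonForgePurge : Prop :=
  ∃ κ μ C : ℝ, 0 ≤ μ ∧ μ < κ ∧ 0 < C ∧ ∀ L : ℝ, 0 < L →
    ∃ h s_b y_a s_a η R₀ : ℝ, 0 < s_b ∧ 0 < s_a ∧ 0 < y_a ∧ 0 < h ∧ 0 < η ∧ 0 < R₀ ∧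
      ∀ θ₁ θ₂ : ℝ → ℝ → ℝ, IsAdmissible L θ₁ θ₂ →
        (∀ x y, |y| ≤ R₀ → vorticity θ₁ θ₂ x y = ribbonVorticity L h s_b y_a s_a x y) →
        (∫ x in Ioc 0 L, ∫ y, |vorticity θ₁ θ₂ x y - ribbonVorticity L h s_b y_a s_a x y| ≤ η) →
        ∃ ν₀ : ℝ, 0 < ν₀ ∧ ∀ ν : ℝ, 0 < ν → ν ≤ ν₀ →
          ∀ u v p : ℝ → ℝ → ℝ → ℝ, InCruxClass ν L θ₁ θ₂ u v p →
            (∀ a b : ℝ, 0 < a → a < b → ExpTails (Icc a b) u v) →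
            ∃ t₀ : ℝ, 0 < t₀ ∧ IsPurgedCore L κ μ (C * Real.sqrt ν) (u t₀) (v t₀)

/-- **S4's statement · persistence of a purged located core (θ-FREE).** For all ledger constants `0 ≤ μ < κ`, `C > 0` there
are `κ′, C′ > 0` (depending on `κ, μ, C` ONLY) such that for every `L` there is `ν₀ > 0` with: for all `ν ∈ (0, ν₀]`, every
classical solution of the bare Literature class on `(0, ∞)` (γ = ΔU = 1, period `L`) with shear tails on compact windows that
has a purged located core `IsPurgedCore L κ μ (C√ν)` at some time `t₀ > 0` carries, from some `T₁` on, in EVERY slice a box of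
half-side `C′√ν` with `|Γ_box| ≥ κ′L`. Parallel (x-independent) members never satisfy the hypothesis; the conclusion is exactly
the `hcore` input of the landed read-out `stub_coreFloor`. Content: ν-uniform nonlinear robustness of the intense (`Re_Γ =
κL/ν`) strained core against zero-net debris of positive mass `≤ μL < κL` — the plane-strain (`λ = 1`) periodic row of
one-signed Burgers-type cores (numerically steady and 2-D-stable at `λ = 1` for all `R`: Prochazka–Pullin 1998, Fig. 2b;
large-`Re_Γ` symmetrisation: Moffatt–Kida–Ohkitani 1994; rigorous existence/stability only for `λ < 1`: Gallay–Wayne, Maekawa,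
Gallay–Maekawa 2016 Thm 4.1; the parallel Burgers LAYER at the same `λ = 1` is KH-unstable above `Re_cr`: Beronov–Kida 1996;
the `ΔU = 0` counter-rotating sibling is Kerr–Dold 1994): no relaminarisation of an intense core. -/
def CorePersistence : Prop :=
  ∀ κ μ C : ℝ, 0 ≤ μ → μ < κ → 0 < C →
    ∃ κ' C' : ℝ, 0 < κ' ∧ 0 < C' ∧ ∀ L : ℝ, 0 < L → ∃ ν₀ : ℝ, 0 < ν₀ ∧ ∀ ν : ℝ, 0 < ν → ν ≤ ν₀ →
      ∀ u v p : ℝ → ℝ → ℝ → ℝ, IsStretchedLayerNSSolutionOn (Ioi 0) ν 1 1 L u v p →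
        (∀ a b : ℝ, 0 < a → a < b → ExpTails (Icc a b) u v) →
        (∃ t₀ : ℝ, 0 < t₀ ∧ IsPurgedCore L κ μ (C * Real.sqrt ν) (u t₀) (v t₀)) →
        ∃ T₁ : ℝ, 0 < T₁ ∧ ∀ t : ℝ, T₁ ≤ t →
          ∃ a b : ℝ, κ' * L ≤ |boxCirc (u t) (v t) a b (C' * Real.sqrt ν)|

/-- **S5's statement · hygiene (shared, verbatim the sum-rule / clock / index-gap lines' `stub_bareClassTails`).** Finite-
dissipation members of the crux's bare class have uniform exponential shear tails on every compact time window `[a, b] ⊂ (0, ∞)`.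
True for the physical (mild) solution; repair-only in the bare class (conditional closure `bareClassTails_of_hasShearLayerTails`,
p120875, under the class repair `HasShearLayerTails`). -/
def BareClassTails : Prop :=
  ∀ (ν L : ℝ), 0 < ν → 0 < L → ∀ (θ₁ θ₂ : ℝ → ℝ → ℝ), IsAdmissible L θ₁ θ₂ →
    ∀ (u v p : ℝ → ℝ → ℝ → ℝ), InCruxClass ν L θ₁ θ₂ u v p →
      (∀ T : ℝ, 0 < T → ∫⁻ t in Ioc 0 T, layerDissipation ν L (u t) (v t) ≠ ∞) →
        ∀ a b : ℝ, 0 < a → a < b → ExpTails (Icc a b) u v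

/-! ## §1 The registered stubs (`sorry` ONLY here) -/

/-- **Stub S1 `stub_kidaNeuForge`** (size M; planar non-autonomous ODE: trapping region of the fast-rotation regime,
averaging over the rotation phase once `|ω₀|eᵗ ≫ 1`). -/
theorem stub_kidaNeuForge : KidaNeuForge := by
  sorry

/-- **Stub S2 `stub_ribbonDatum`** (size M; stream-function construction with a far cut-off). -/
theorem stub_ribbonDatum : RibbonDatum := by
  sorry

/-- **Stub S3 `stub_ribbonForgePurge`** (size L/XL⁻; GIVEN the forge S1: finite-time ν-uniform tracking of the blob row
(Marchioro-type localisation + S1 shape control down to the viscous scale), then the fixed-ν shielded melee and purge). -/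
theorem stub_ribbonForgePurge : KidaNeuForge → RibbonForgePurge := by
  sorry

/-- **Stub S4 `stub_corePersistence`** (size XL, HARDEST; θ-free ν-uniform robustness of the purged plane-strain core row). -/
theorem stub_corePersistence : CorePersistence := by
  sorry

/-- **Stub S5 `stub_bareClassTails`** (hygiene, shared registered signature; closes under the class repair, p120875). -/
theorem stub_bareClassTails : ∀ (ν L : ℝ), 0 < ν → 0 < L → ∀ (θ₁ θ₂ : ℝ → ℝ → ℝ), IsAdmissible L θ₁ θ₂ →
    ∀ (u v p : ℝ → ℝ → ℝ → ℝ), InCruxClass ν L θ₁ θ₂ u v p →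
      (∀ T : ℝ, 0 < T → ∫⁻ t in Ioc 0 T, layerDissipation ν L (u t) (v t) ≠ ∞) →
        ∀ a b : ℝ, 0 < a → a < b → ExpTails (Icc a b) u v := by
  sorry

/-! ## §2 The composition (sorry-free): S1, S2, S3, S4, S5 ⇒ the crux BY NAME -/

/-- **Conditional composition (sorry-free).** `(κ, μ, C)` from S3 fed with S1; `(κ′, C′)` from S4; `c := κ′²/(8C′²)`. Given
`L`: geometry from S3, `θ` from S2, `ν₁` from S3, `ν₂` from S4, `ν₀ := min (min ν₁ ν₂) (L²/(4C′²))` (so that `2C′√ν ≤ L`, the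
box fits in one period). Per member: if some `∫⁻_{(0,T₀]} D = ⊤` the Cesàro means are eventually `⊤`; else S5 gives tails, S3
a purged core at some `t₀`, S4 a located core of strength `κ′L` in a box of half-side `C′√ν` for all `t ≥ T₁`, and the LANDED
`stub_coreFloor` (n = 1) the floor `ofReal(ν(κ′L)²/(8(C′√ν)²L)) = ofReal(κ′²L/(8C′²)) ≥ ofReal(c·min L 1)`. -/
theorem StrainedLayerLaw_of_ribbonStubs (h1 : KidaNeuForge) (h2 : RibbonDatum) (h3 : KidaNeuForge → RibbonForgePurge)
    (h4 : CorePersistence) (h5 : BareClassTails) : StrainedLayerLaw := by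
  obtain ⟨κ, μ, C, hμ, hμκ, hC, hS3⟩ := h3 h1
  obtain ⟨κ', C', hκ', hC', hS4⟩ := h4 κ μ C hμ hμκ hC
  refine ⟨κ' ^ 2 / (8 * C' ^ 2), by positivity, ?_⟩
  intro L hL
  obtain ⟨H, s_b, y_a, s_a, η, R₀, hsb, hsa, hya, hH, hη, hR₀, hgeo⟩ := hS3 L hL
  obtain ⟨θ₁, θ₂, hadm, heq, hL1⟩ := h2 L H s_b y_a s_a η R₀ hL hsb hsa hya hH hη hR₀
  obtain ⟨ν₁, hν₁, hpurge⟩ := hgeo θ₁ θ₂ hadm heq hL1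
  obtain ⟨ν₂, hν₂, hpers⟩ := hS4 L hL
  have hν₃ : 0 < L ^ 2 / (4 * C' ^ 2) := by positivity
  refine ⟨min (min ν₁ ν₂) (L ^ 2 / (4 * C' ^ 2)), lt_min (lt_min hν₁ hν₂) hν₃, θ₁, θ₂,
    hadm.1, hadm.2.1, hadm.2.2.1, hadm.2.2.2.1, hadm.2.2.2.2, ?_⟩
  intro ν hν hνle u v p
  show InCruxClass ν L θ₁ θ₂ u v p →
    ENNReal.ofReal (κ' ^ 2 / (8 * C' ^ 2) * min L 1) ≤ meanLayerDissipation ν L u v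
  intro hcl
  have hsol : IsStretchedLayerNSSolutionOn (Ioi 0) ν 1 1 L u v p := hcl.isSolution
  by_cases hfin : ∀ T : ℝ, 0 < T → ∫⁻ t in Ioc 0 T, layerDissipation ν L (u t) (v t) ≠ ∞
  swap
  · -- some initial dissipation integral is infinite: the Cesàro means are eventually `⊤`
    push Not at hfin
    obtain ⟨T₀, hT₀, htop⟩ := hfin
    rw [meanLayerDissipation_def]
    have hev : ∀ᶠ T in atTop,
        ENNReal.ofReal T⁻¹ * ∫⁻ t in Ioc 0 T, layerDissipation ν L (u t) (v t) = (⊤ : ℝ≥0∞) := by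
      filter_upwards [eventually_ge_atTop T₀] with T hT
      have hmono : ∫⁻ t in Ioc 0 T₀, layerDissipation ν L (u t) (v t) ≤
          ∫⁻ t in Ioc 0 T, layerDissipation ν L (u t) (v t) :=
        lintegral_mono_set (Ioc_subset_Ioc_right hT)
      rw [htop, top_le_iff] at hmono
      rw [hmono, ENNReal.mul_top]
      exact (ENNReal.ofReal_pos.mpr (inv_pos.mpr (hT₀.trans_le hT))).ne'
    rw [Filter.liminf_congr hev, Filter.liminf_const]
    exact le_top
  · -- locally finite dissipation: tails (S5), purge (S3), persistence (S4), read-out (`stub_coreFloor`)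
    have htails : ∀ a b : ℝ, 0 < a → a < b → ExpTails (Icc a b) u v :=
      h5 ν L hν hL θ₁ θ₂ hadm u v p hcl hfin
    have hle₁ : ν ≤ ν₁ := hνle.trans ((min_le_left _ _).trans (min_le_left _ _))
    have hle₂ : ν ≤ ν₂ := hνle.trans ((min_le_left _ _).trans (min_le_right _ _))
    have hle₃ : ν ≤ L ^ 2 / (4 * C' ^ 2) := hνle.trans (min_le_right _ _)
    obtain ⟨t₀, ht₀, hcore₀⟩ := hpurge ν hν hle₁ u v p hcl htails
    obtain ⟨T₁, hT₁, hcore⟩ := hpers ν hν hle₂ u v p hsol htails ⟨t₀, ht₀, hcore₀⟩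
    have hρ : 0 < C' * Real.sqrt ν := mul_pos hC' (Real.sqrt_pos.2 hν)
    have hρL : 2 * (C' * Real.sqrt ν) ≤ L := by
      have h1 : Real.sqrt ν ≤ Real.sqrt (L ^ 2 / (4 * C' ^ 2)) := Real.sqrt_le_sqrt hle₃
      have h2 : Real.sqrt (L ^ 2 / (4 * C' ^ 2)) = L / (2 * C') := by
        rw [show L ^ 2 / (4 * C' ^ 2) = (L / (2 * C')) ^ 2 by field_simp; ring]
        exact Real.sqrt_sq (by positivity)
      have h3 : C' * Real.sqrt ν ≤ C' * (L / (2 * C')) :=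
        mul_le_mul_of_nonneg_left (h1.trans h2.le) hC'.le
      have h4 : C' * (L / (2 * C')) = L / 2 := by field_simp
      linarith [h3, h4]
    have hreg : ∀ t : ℝ, 0 < t →
        ContDiff ℝ 2 (fun q : ℝ × ℝ => u t q.1 q.2) ∧ ContDiff ℝ 2 (fun q : ℝ × ℝ => v t q.1 q.2) :=
      fun t ht => ⟨hsol.contDiff_u ht, hsol.contDiff_v ht⟩
    have hper : ∀ t x y : ℝ, 0 < t → u t (x + L) y = u t x y ∧ v t (x + L) y = v t x y :=
      fun t x y ht => ⟨hsol.periodic_u t ht x y, hsol.periodic_v t ht x y⟩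
    have hΓ₀ : (0 : ℝ) ≤ κ' * L := by positivity
    have hfloor := stub_coreFloor (n := 1) hν hL le_rfl hρ hρL hΓ₀ hT₁ hreg hper hcore
    rw [Nat.cast_one, one_mul] at hfloor
    refine le_trans (ENNReal.ofReal_le_ofReal ?_) hfloor
    have hν0 : ν ≠ 0 := hν.ne'
    have hL0 : L ≠ 0 := hL.ne'
    have hC0 : C' ≠ 0 := hC'.ne'
    have hsq : Real.sqrt ν ^ 2 = ν := Real.sq_sqrt hν.le
    have hkey : ν * (κ' * L) ^ 2 / (8 * (C' * Real.sqrt ν) ^ 2 * L) = κ' ^ 2 / (8 * C' ^ 2) * L := by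
      rw [mul_pow C' (Real.sqrt ν) 2, hsq]
      field_simp
    rw [hkey]
    exact mul_le_mul_of_nonneg_left (min_le_left L 1) (by positivity)

/-- **Composition.** The five registered stubs, fed to the sorry-free conditional composition, prove the crux BY NAME. -/
theorem StrainedLayerLaw_of : StrainedLayerLaw :=
  StrainedLayerLaw_of_ribbonStubs stub_kidaNeuForge stub_ribbonDatum stub_ribbonForgePurge stub_corePersistence
    stub_bareClassTails

end Summit.AnomalousDissipation.AnomalousDissipation.Cruxes.StrainedLayerLaw.OrderedRibbonForgedCore

end
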